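import Literature.Analysis.FluidPDE.LadyzhenskayaWeightedEstimate
import HarnessLib

/-!
# The enstrophy inequality for axisymmetric flows without swirl (whole space)

Analysis/FluidPDE proof file (all results proved, no definitions) on the decomposition path of
the named fact `Literature.Analysis.FluidPDE.axisymmetricNoSwirl_enstrophy_apriori`
(Lemarié-Rieusset 2016, Thm. 10.4). It supplies the second energy-type ingredient of the
printed proof (p. 289): for an axisymmetric flow without swirl,
`∂ₜ‖ω‖₂² = −2ν‖∇⊗ω‖₂² + 2∫ u_r ω_θ²/r dx`, where the stretching density obeys
`|u_r ω_θ²/r| ≤ |u| |ω_θ/r| |ω_θ|`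
(`AxisymVorticityAlgebra.abs_inner_stretch_le_of_eq_smul_rotGen`).
On the whole space the identity is first localised with the squared ball cutoff `χ_R` of
`AxisymWeights` (Tao's weighted enstrophy identity,
`TaoEnstrophyIdentity.integral_enstrophyProduction_mul_weight`), the cutoff-derivative terms are
`O(R⁻¹)` for a classical solution with `ω, ∇ω ∈ L²` uniformly on the slab, and `R → ∞`:

* `localisedEnstrophy_sub_eq_integral` — the localised enstrophy balance for a static weight,
  integrated in time (fundamental theorem of calculus);
* `enstrophyProduction_sqBallCutoff_le` — at a fixed time,
  `∫⟨ω,∂ₜω⟩χ_R ≤ −ν∫|Dω|²_Fχ_R + C/R + Φ` whenever `∫ |f| |ω| |u| ≤ Φ` (`f = ω_θ/r`);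
* `enstrophy_sqBallCutoff_integral_le` — integrated in time;
* `aestronglyMeasurable_enstrophy`, `aestronglyMeasurable_dissipation` — measurability in time
  of `∫|ω(t)|²`, `∫|Dω(t)|²_F` (limits of the continuous truncated quantities);
* `enstrophy_integral_le` — **the whole-space enstrophy inequality**
  `‖ω(t)‖₂² + 2ν∫₀ᵗ‖∇ω‖₂² ≤ ‖ω(0)‖₂² + 2∫₀ᵗ Φ` for any `L¹` majorant `Φ` of the stretching
  integrals (dominated convergence in space and time).

The data-dependent choice of `Φ` (Sobolev bound for `‖u‖_∞`, Ladyzhenskaya's estimate for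
`‖ω_θ/r‖₂`, Young's inequality) and Grönwall's lemma are carried out in
`AxisymmetricNoSwirlAprioriProofs`.

## References

* P. G. Lemarié-Rieusset, *The Navier–Stokes Problem in the 21st Century*, CRC Press (2016),
  §10.3, proof of Thm. 10.4, pp. 288–289. [LemarieRieusset2016]
-/

noncomputable section

open Set Function Filter MeasureTheory Metric Topology intervalIntegral
open scoped RealInnerProductSpace ENNReal NNReal Topology Interval

namespace Literature.Analysis.FluidPDE

/-! ### Static weights: continuity in time of the weighted dissipation and production; FTC -/

section Static

variable {T : ℝ} {w : ℝ → EuclideanSpace ℝ (Fin 3) → EuclideanSpace ℝ (Fin 3)}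

/-- The weighted dissipation `∫ |D curl w(t)|²_F φ` against a continuous compactly supported
static weight is continuous on the closed slab. [folklore] -/
theorem continuousOn_localisedEnstrophyDissipation_static (hT : 0 < T)
    (hw : IsSmoothSpaceTimeOn (Icc 0 T) w) {φ : EuclideanSpace ℝ (Fin 3) → ℝ}
    (hφ : Continuous φ) (hφc : HasCompactSupport φ) :
    ContinuousOn (fun t => localisedEnstrophyDissipation φ (w t)) (Icc 0 T) := by
  have hK : IsCompact (tsupport φ) := hφc
  have hFrc : Continuous (frobeniusNormSq :
      (EuclideanSpace ℝ (Fin 3) →L[ℝ] EuclideanSpace ℝ (Fin 3)) → ℝ) := by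
    unfold frobeniusNormSq
    exact continuous_finsetSum _ fun i _ =>
      ((ContinuousLinearMap.apply ℝ (EuclideanSpace ℝ (Fin 3))
        (stdOrthonormalBasis ℝ (EuclideanSpace ℝ (Fin 3)) i)).continuous.norm).pow 2
  have hc : ContinuousOn (uncurry fun (t : ℝ) (x : EuclideanSpace ℝ (Fin 3)) =>
      frobeniusNormSq (fderiv ℝ (curl (w t)) x) * φ x) (Icc 0 T ×ˢ univ) :=
    (hFrc.comp_continuousOn (continuousOn_fderiv_curl_slab' hT hw)).mul
      (hφ.comp continuous_snd).continuousOn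
  have hzero : ∀ (t : ℝ) (x : EuclideanSpace ℝ (Fin 3)), t ∈ Icc 0 T → x ∉ tsupport φ →
      frobeniusNormSq (fderiv ℝ (curl (w t)) x) * φ x = 0 := fun t x _ hx => by
    rw [image_eq_zero_of_notMem_tsupport hx, mul_zero]
  exact continuousOn_integral_of_compact_support (μ := volume) hK hc hzero

/-- The production `∫ ⟨ω, ∂ₜω⟩(t) φ` against a continuous compactly supported static weight is
continuous on the closed slab. [folklore] -/
theorem continuousOn_integral_enstrophyProduction_static (hT : 0 < T)
    (hw : IsSmoothSpaceTimeOn (Icc 0 T) w) {φ : EuclideanSpace ℝ (Fin 3) → ℝ}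
    (hφ : Continuous φ) (hφc : HasCompactSupport φ) :
    ContinuousOn (fun t => ∫ x, enstrophyProduction T w t x * φ x) (Icc 0 T) := by
  have hK : IsCompact (tsupport φ) := hφc
  have hc : ContinuousOn (uncurry fun (t : ℝ) (x : EuclideanSpace ℝ (Fin 3)) =>
      enstrophyProduction T w t x * φ x) (Icc 0 T ×ˢ univ) :=
    (continuousOn_enstrophyProduction hT hw).mul (hφ.comp continuous_snd).continuousOn
  have hzero : ∀ (t : ℝ) (x : EuclideanSpace ℝ (Fin 3)), t ∈ Icc 0 T → x ∉ tsupport φ →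
      enstrophyProduction T w t x * φ x = 0 := fun t x _ hx => by
    rw [image_eq_zero_of_notMem_tsupport hx, mul_zero]
  exact continuousOn_integral_of_compact_support (μ := volume) hK hc hzero

/-- **The localised enstrophy balance for a static weight, integrated in time**:
`½∫|ω(t)|²φ − ½∫|ω(0)|²φ = ∫₀ᵗ (∫⟨ω, ∂ₜω⟩φ) ds` for `t ∈ [0, T]` (fundamental theorem of
calculus: the localised enstrophy is continuous on `[0, T]` and has the production as derivative
at interior times). [folklore] -/
theorem localisedEnstrophy_sub_eq_integral (hT : 0 < T) (hw : IsSmoothSpaceTimeOn (Icc 0 T) w)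
    {φ : EuclideanSpace ℝ (Fin 3) → ℝ} (hφ : Continuous φ) (hφc : HasCompactSupport φ)
    {t : ℝ} (ht : t ∈ Icc 0 T) :
    localisedEnstrophy φ (w t) - localisedEnstrophy φ (w 0) =
      ∫ s in (0 : ℝ)..t, ∫ x, enstrophyProduction T w s x * φ x := by
  have hK : IsCompact (tsupport φ) := hφc
  have hsupp : ∀ x ∉ tsupport φ, φ x = 0 := fun x hx => image_eq_zero_of_notMem_tsupport hx
  have hWc := (continuousOn_localisedEnstrophy_static hT hw hφ hφc).mono
    (Icc_subset_Icc le_rfl ht.2)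
  have hPc := continuousOn_integral_enstrophyProduction_static hT hw hφ hφc
  have hderiv : ∀ s ∈ Ioo 0 t, HasDerivAt (fun s => localisedEnstrophy φ (w s))
      (∫ x, enstrophyProduction T w s x * φ x) s := fun s hs =>
    hasDerivAt_localisedEnstrophy_frozen hT hw hφ hK hsupp ⟨hs.1, hs.2.trans_le ht.2⟩
  have hint : IntervalIntegrable (fun s => ∫ x, enstrophyProduction T w s x * φ x) volume 0 t :=
    (hPc.mono (Icc_subset_Icc le_rfl ht.2)).intervalIntegrable_of_Icc ht.1
  exact (integral_eq_sub_of_hasDerivAt_of_le ht.1 hWc hderiv hint).symm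

end Static

/-! ### The slice inequality against the ball cutoff -/

section Slice

variable {T ν : ℝ} {u : ℝ → EuclideanSpace ℝ (Fin 3) → EuclideanSpace ℝ (Fin 3)}
  {p : ℝ → EuclideanSpace ℝ (Fin 3) → ℝ}

/-- **The enstrophy production against the ball cutoff, axisymmetric flow without swirl**
(Lemarié-Rieusset 2016, p. 289: `∂ₜ‖ω‖₂² = −2ν‖ω‖²_{Ḣ¹} + 2∫ u_r ω_θ²/r dx`, here localised
with `χ_R` on the whole space). For a classical solution on `[0, T] × ℝ³` whose slice `u(t)` is
axisymmetric without swirl, with `|u(t)| ≤ V`, `∫|ω(t)|² ≤ Y⋆`, `∫|Dω(t)|²_F ≤ D⋆`, and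
`∫ |f| |ω| |u| ≤ Φ` (`f = ω_θ/r`):
`∫⟨ω,∂ₜω⟩χ_R ≤ −ν ∫|Dω|²_F χ_R + (6√2νD(Y⋆ + D⋆) + 2√2DVY⋆)/R + Φ`
(viscous cross term and transport term are `O(R⁻¹)` by `‖Dχ_R‖ ≤ 4√2D/R`; the stretching
term is bounded through `|⟨ω,(ω·∇)u⟩| ≤ |f||ω||u|`). [cite: LemarieRieusset2016, §10.3 p. 289] -/
theorem enstrophyProduction_sqBallCutoff_le (hT : 0 < T) (hν : 0 ≤ ν)
    (hsol : IsClassicalNSSolutionOn (Icc 0 T) ν 0 u p) {t : ℝ} (ht : t ∈ Icc 0 T)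
    (hax : IsAxisymmetric (u t)) (hsw : HasNoSwirl (u t))
    {D : ℝ} (hD : ∀ s, |deriv Real.smoothTransition s| ≤ D) {R : ℝ} (hR : 1 ≤ R)
    {V Ystar Dstar Φ : ℝ} (hV : ∀ x, ‖u t x‖ ≤ V)
    (hY : Integrable fun x => ‖curl (u t) x‖ ^ 2) (hYstar : ∫ x, ‖curl (u t) x‖ ^ 2 ≤ Ystar)
    (hDi : Integrable fun x => frobeniusNormSq (fderiv ℝ (curl (u t)) x))
    (hDstar : ∫ x, frobeniusNormSq (fderiv ℝ (curl (u t)) x) ≤ Dstar)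
    (hSi : Integrable fun x =>
      |hadamardQuotFst (fun y => curl (u t) y 1) x| * ‖curl (u t) x‖ * ‖u t x‖)
    (hΦ : ∫ x, |hadamardQuotFst (fun y => curl (u t) y 1) x| * ‖curl (u t) x‖ * ‖u t x‖ ≤ Φ) :
    ∫ x, enstrophyProduction T u t x * Real.smoothTransition (2 - ‖x‖ ^ 2 / R ^ 2) ^ 2 ≤
      -(ν * ∫ x, frobeniusNormSq (fderiv ℝ (curl (u t)) x) *
          Real.smoothTransition (2 - ‖x‖ ^ 2 / R ^ 2) ^ 2) +
        (6 * Real.sqrt 2 * ν * D * (Ystar + Dstar) + 2 * Real.sqrt 2 * D * V * Ystar) / R + Φ := by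
  set f : EuclideanSpace ℝ (Fin 3) → ℝ := hadamardQuotFst (fun y => curl (u t) y 1) with hfdef
  set χ : EuclideanSpace ℝ (Fin 3) → ℝ := fun y =>
    Real.smoothTransition (2 - ‖y‖ ^ 2 / R ^ 2) ^ 2 with hχdef
  have hR0 : 0 < R := by linarith
  have hD0 : 0 ≤ D := (abs_nonneg _).trans (hD 0)
  have hV0 : 0 ≤ V := (norm_nonneg _).trans (hV 0)
  have hY0 : 0 ≤ Ystar := (integral_nonneg fun x => sq_nonneg _).trans hYstar
  have hDs0 : 0 ≤ Dstar := (integral_nonneg fun x => frobeniusNormSq_nonneg _).trans hDstar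
  -- regularity of the slice
  have hu3 : ContDiff ℝ 3 (u t) := (hsol.contDiff_velocity ht).of_le (by norm_cast)
  have hu2 : ContDiff ℝ 2 (u t) := hu3.of_le (by norm_cast)
  have hu1 : ContDiff ℝ 1 (u t) := hu3.of_le (by norm_cast)
  have hω : curl (u t) = fun y => f y • rotGen y :=
    funext fun y => curl_eq_hadamardQuotFst_smul_rotGen hax hsw hu2 y
  have hax' : ∀ x, fderiv ℝ (u t) x (rotGen x) = rotGen (u t x) := fun x =>
    hax.fderiv_rotGen ((hu1.differentiable one_ne_zero) x)
  have hω1 : ContDiff ℝ 1 (curl (u t)) := contDiff_curl (n := 1) (by exact_mod_cast hu2)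
  have hωc : Continuous (curl (u t)) := hω1.continuous
  have hDωc : Continuous (fderiv ℝ (curl (u t))) := hω1.continuous_fderiv one_ne_zero
  have huc : Continuous (u t) := hu1.continuous
  have hDuc : Continuous (fderiv ℝ (u t)) := hu1.continuous_fderiv one_ne_zero
  -- the weight
  have hχs : ContDiff ℝ 1 χ := contDiff_sqBallCutoff R
  have hχc : HasCompactSupport χ := hasCompactSupport_sqBallCutoff hR0
  obtain ⟨K, hK⟩ : ∃ K, LipschitzWith K χ := exists_lipschitzWith_sqBallCutoff hR0
  have hχd : ∀ x, DifferentiableAt ℝ χ x := fun x => (hχs.differentiable one_ne_zero) x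
  have hχcont : Continuous χ := hχs.continuous
  have hDχc : HasCompactSupport (fderiv ℝ χ) := hχc.fderiv ℝ
  have hDχcont : Continuous (fderiv ℝ χ) := hχs.continuous_fderiv one_ne_zero
  have hDχ : ∀ x, ‖fderiv ℝ χ x‖ ≤ 4 * Real.sqrt 2 * D / R := fun x =>
    norm_fderiv_sqBallCutoff_le' hD hR0 x
  have hχ01 : ∀ x, 0 ≤ χ x ∧ χ x ≤ 1 := fun x => ⟨sqBallCutoff_nonneg R x, sqBallCutoff_le_one R x⟩
  -- the identity (10.11) with `f = 0`
  have hid := integral_enstrophyProduction_mul_weight hT hsol ht hK hχc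
  have hf0 : (∫ x, ⟪curl (u t) x, curl ((0 : ℝ → EuclideanSpace ℝ (Fin 3) →
      EuclideanSpace ℝ (Fin 3)) t) x⟫ * χ x) = 0 := by
    simp [curl_zero]
  rw [hf0, add_zero] at hid
  have hld : ∀ x v, lineDeriv ℝ χ x v = fderiv ℝ χ x v := fun x v =>
    (hχd x).lineDeriv_eq_fderiv
  simp_rw [hld] at hid
  rw [hid]
  -- (i) the viscous cross term is `O(1/R)`
  have hcross : ∀ j : Fin 3, |∫ x, ⟪curl (u t) x, fderiv ℝ (curl (u t)) x
      (EuclideanSpace.single j (1 : ℝ))⟫ * fderiv ℝ χ x (EuclideanSpace.single j (1 : ℝ))| ≤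
      2 * Real.sqrt 2 * D / R * (Ystar + Dstar) := by
    intro j
    have hsingle : ‖(EuclideanSpace.single j (1 : ℝ) : EuclideanSpace ℝ (Fin 3))‖ = 1 := by
      rw [PiLp.norm_single, norm_one]
    have hpt : ∀ x, |⟪curl (u t) x, fderiv ℝ (curl (u t)) x (EuclideanSpace.single j (1 : ℝ))⟫ *
        fderiv ℝ χ x (EuclideanSpace.single j (1 : ℝ))| ≤
        2 * Real.sqrt 2 * D / R *
          (‖curl (u t) x‖ ^ 2 + frobeniusNormSq (fderiv ℝ (curl (u t)) x)) := by
      intro x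
      rw [abs_mul]
      have h1 : |⟪curl (u t) x, fderiv ℝ (curl (u t)) x (EuclideanSpace.single j (1 : ℝ))⟫| ≤
          ‖curl (u t) x‖ * ‖fderiv ℝ (curl (u t)) x‖ := by
        refine (abs_real_inner_le_norm _ _).trans (mul_le_mul_of_nonneg_left ?_ (norm_nonneg _))
        calc _ ≤ ‖fderiv ℝ (curl (u t)) x‖ * ‖(EuclideanSpace.single j (1 : ℝ) :
            EuclideanSpace ℝ (Fin 3))‖ := ContinuousLinearMap.le_opNorm _ _
          _ = _ := by rw [hsingle, mul_one]
      have h2 : |fderiv ℝ χ x (EuclideanSpace.single j (1 : ℝ))| ≤ 4 * Real.sqrt 2 * D / R := by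
        rw [← Real.norm_eq_abs]
        calc _ ≤ ‖fderiv ℝ χ x‖ * ‖(EuclideanSpace.single j (1 : ℝ) : EuclideanSpace ℝ (Fin 3))‖ :=
            ContinuousLinearMap.le_opNorm _ _
          _ ≤ 4 * Real.sqrt 2 * D / R := by rw [hsingle, mul_one]; exact hDχ x
      have h3 : ‖fderiv ℝ (curl (u t)) x‖ ^ 2 ≤ frobeniusNormSq (fderiv ℝ (curl (u t)) x) :=
        sq_opNorm_le_frobeniusNormSq _
      have h4 : ‖curl (u t) x‖ * ‖fderiv ℝ (curl (u t)) x‖ ≤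
          (‖curl (u t) x‖ ^ 2 + frobeniusNormSq (fderiv ℝ (curl (u t)) x)) / 2 := by
        nlinarith [sq_nonneg (‖curl (u t) x‖ - ‖fderiv ℝ (curl (u t)) x‖)]
      calc _ ≤ (‖curl (u t) x‖ * ‖fderiv ℝ (curl (u t)) x‖) * (4 * Real.sqrt 2 * D / R) :=
            mul_le_mul h1 h2 (abs_nonneg _) (by positivity)
        _ ≤ (‖curl (u t) x‖ ^ 2 + frobeniusNormSq (fderiv ℝ (curl (u t)) x)) / 2 *
            (4 * Real.sqrt 2 * D / R) := by gcongr
        _ = _ := by ring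
    have hI : Integrable fun x => ⟪curl (u t) x, fderiv ℝ (curl (u t)) x
        (EuclideanSpace.single j (1 : ℝ))⟫ * fderiv ℝ χ x (EuclideanSpace.single j (1 : ℝ)) :=
      integrable_mul_of_continuous_of_hasCompactSupport
        (hωc.inner (hDωc.clm_apply continuous_const)) (hDχcont.clm_apply continuous_const)
        (hDχc.mono fun x hx => by
          simp only [mem_support, ne_eq] at hx ⊢
          intro h; exact hx (by rw [h]; rfl))
    calc _ ≤ ∫ x, |⟪curl (u t) x, fderiv ℝ (curl (u t)) x (EuclideanSpace.single j (1 : ℝ))⟫ *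
          fderiv ℝ χ x (EuclideanSpace.single j (1 : ℝ))| := abs_integral_le_integral_abs
      _ ≤ ∫ x, 2 * Real.sqrt 2 * D / R *
          (‖curl (u t) x‖ ^ 2 + frobeniusNormSq (fderiv ℝ (curl (u t)) x)) :=
          integral_mono hI.abs ((hY.add hDi).const_mul _) hpt
      _ = 2 * Real.sqrt 2 * D / R * ((∫ x, ‖curl (u t) x‖ ^ 2) +
          ∫ x, frobeniusNormSq (fderiv ℝ (curl (u t)) x)) := by
          rw [MeasureTheory.integral_const_mul, integral_add hY hDi]
      _ ≤ 2 * Real.sqrt 2 * D / R * (Ystar + Dstar) := by gcongr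
  have hcross' : -(ν * ∑ j : Fin 3, ∫ x, ⟪curl (u t) x, fderiv ℝ (curl (u t)) x
      (EuclideanSpace.single j (1 : ℝ))⟫ * fderiv ℝ χ x (EuclideanSpace.single j (1 : ℝ))) ≤
      ν * (6 * Real.sqrt 2 * D / R * (Ystar + Dstar)) := by
    have hsum : |∑ j : Fin 3, ∫ x, ⟪curl (u t) x, fderiv ℝ (curl (u t)) x
        (EuclideanSpace.single j (1 : ℝ))⟫ * fderiv ℝ χ x (EuclideanSpace.single j (1 : ℝ))| ≤
        6 * Real.sqrt 2 * D / R * (Ystar + Dstar) := by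
      refine (Finset.abs_sum_le_sum_abs _ _).trans ?_
      calc _ ≤ ∑ j : Fin 3, 2 * Real.sqrt 2 * D / R * (Ystar + Dstar) :=
            Finset.sum_le_sum fun j _ => hcross j
        _ = _ := by rw [Fin.sum_univ_three]; ring
    have := neg_abs_le (∑ j : Fin 3, ∫ x, ⟪curl (u t) x, fderiv ℝ (curl (u t)) x
        (EuclideanSpace.single j (1 : ℝ))⟫ * fderiv ℝ χ x (EuclideanSpace.single j (1 : ℝ)))
    nlinarith [mul_le_mul_of_nonneg_left hsum hν]
  -- (ii) the transport term is `O(1/R)`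
  have htrans : |∫ x, ‖curl (u t) x‖ ^ 2 * fderiv ℝ χ x (u t x)| ≤
      4 * Real.sqrt 2 * D / R * V * Ystar := by
    have hpt : ∀ x, |‖curl (u t) x‖ ^ 2 * fderiv ℝ χ x (u t x)| ≤
        4 * Real.sqrt 2 * D / R * V * ‖curl (u t) x‖ ^ 2 := by
      intro x
      rw [abs_mul, abs_of_nonneg (sq_nonneg _)]
      have h1 : |fderiv ℝ χ x (u t x)| ≤ 4 * Real.sqrt 2 * D / R * V := by
        rw [← Real.norm_eq_abs]
        calc _ ≤ ‖fderiv ℝ χ x‖ * ‖u t x‖ := ContinuousLinearMap.le_opNorm _ _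
          _ ≤ 4 * Real.sqrt 2 * D / R * V :=
            mul_le_mul (hDχ x) (hV x) (norm_nonneg _) (by positivity)
      calc _ ≤ ‖curl (u t) x‖ ^ 2 * (4 * Real.sqrt 2 * D / R * V) :=
          mul_le_mul_of_nonneg_left h1 (sq_nonneg _)
        _ = _ := by ring
    have hI : Integrable fun x => ‖curl (u t) x‖ ^ 2 * fderiv ℝ χ x (u t x) :=
      integrable_mul_of_continuous_of_hasCompactSupport (hωc.norm.pow 2) (hDχcont.clm_apply huc)
        (hDχc.mono fun x hx => by
          simp only [mem_support, ne_eq] at hx ⊢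
          intro h; exact hx (by rw [h]; rfl))
    calc _ ≤ ∫ x, |‖curl (u t) x‖ ^ 2 * fderiv ℝ χ x (u t x)| := abs_integral_le_integral_abs
      _ ≤ ∫ x, 4 * Real.sqrt 2 * D / R * V * ‖curl (u t) x‖ ^ 2 :=
          integral_mono hI.abs (hY.const_mul _) hpt
      _ = 4 * Real.sqrt 2 * D / R * V * ∫ x, ‖curl (u t) x‖ ^ 2 :=
          MeasureTheory.integral_const_mul _ _
      _ ≤ 4 * Real.sqrt 2 * D / R * V * Ystar := by gcongr
  have htrans' : 1 / 2 * (∫ x, ‖curl (u t) x‖ ^ 2 * fderiv ℝ χ x (u t x)) ≤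
      2 * Real.sqrt 2 * D / R * V * Ystar := by
    have h1 := (le_abs_self (∫ x, ‖curl (u t) x‖ ^ 2 * fderiv ℝ χ x (u t x))).trans htrans
    have h2 : (1 : ℝ) / 2 * (4 * Real.sqrt 2 * D / R * V * Ystar) =
        2 * Real.sqrt 2 * D / R * V * Ystar := by ring
    rw [← h2]
    exact mul_le_mul_of_nonneg_left h1 (by norm_num)
  -- (iii) the stretching term
  have hstretch : (∫ x, ⟪curl (u t) x, convect (curl (u t)) (u t) x⟫ * χ x) ≤ Φ := by
    have hpt : ∀ x, ⟪curl (u t) x, convect (curl (u t)) (u t) x⟫ * χ x ≤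
        |f x| * ‖curl (u t) x‖ * ‖u t x‖ := by
      intro x
      rw [convect_apply]
      have hωx : curl (u t) x = f x • rotGen x := by rw [hω]
      have h1 := abs_inner_stretch_le_of_eq_smul_rotGen hωx (hax' x)
      have h2 := le_abs_self ⟪curl (u t) x, fderiv ℝ (u t) x (curl (u t) x)⟫
      have h3 : 0 ≤ |f x| * ‖curl (u t) x‖ * ‖u t x‖ := by positivity
      calc _ ≤ |⟪curl (u t) x, fderiv ℝ (u t) x (curl (u t) x)⟫| * χ x :=
            mul_le_mul_of_nonneg_right h2 (hχ01 x).1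
        _ ≤ |f x| * ‖curl (u t) x‖ * ‖u t x‖ * 1 :=
            mul_le_mul h1 (hχ01 x).2 (hχ01 x).1 h3
        _ = _ := mul_one _
    have hI : Integrable fun x => ⟪curl (u t) x, convect (curl (u t)) (u t) x⟫ * χ x :=
      integrable_mul_of_continuous_of_hasCompactSupport
        (hωc.inner (hDuc.clm_apply hωc)) hχcont hχc
    exact (integral_mono hI hSi hpt).trans hΦ
  -- collect
  have hRle :
      ν * (6 * Real.sqrt 2 * D / R * (Ystar + Dstar)) + 2 * Real.sqrt 2 * D / R * V * Ystar =
      (6 * Real.sqrt 2 * ν * D * (Ystar + Dstar) + 2 * Real.sqrt 2 * D * V * Ystar) / R := by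
    field_simp
  linarith [hcross', htrans', hstretch, hRle]

end Slice

/-! ### Time integration against the ball cutoff -/

section Integrated

variable {T ν : ℝ} {u : ℝ → EuclideanSpace ℝ (Fin 3) → EuclideanSpace ℝ (Fin 3)}
  {p : ℝ → EuclideanSpace ℝ (Fin 3) → ℝ}

/-- **The enstrophy inequality against the ball cutoff, integrated in time**: under uniform (in
`t ∈ [0, T]`) versions of the hypotheses of `enstrophyProduction_sqBallCutoff_le` and with a
majorant `Φ ∈ L¹(0, T)` of the stretching integrals `∫ |f| |ω| |u|`,
`½∫|ω(t)|²χ_R − ½∫|ω(0)|²χ_R + ν∫₀ᵗ∫|Dω|²_Fχ_R ≤ C t/R + ∫₀ᵗ Φ`,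
`C = 6√2νD(Y⋆ + D⋆) + 2√2DVY⋆` (fundamental theorem of calculus for the localised enstrophy,
`localisedEnstrophy_sub_eq_integral`, and the slice inequality at every time of `[0, t]`).
[cite: LemarieRieusset2016, §10.3 p. 289] -/
theorem enstrophy_sqBallCutoff_integral_le (hT : 0 < T) (hν : 0 ≤ ν)
    (hsol : IsClassicalNSSolutionOn (Icc 0 T) ν 0 u p)
    (hax : ∀ s ∈ Icc 0 T, IsAxisymmetric (u s)) (hsw : ∀ s ∈ Icc 0 T, HasNoSwirl (u s))
    {D : ℝ} (hD : ∀ s, |deriv Real.smoothTransition s| ≤ D) {R : ℝ} (hR : 1 ≤ R)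
    {V Ystar Dstar : ℝ} (hV : ∀ s ∈ Icc 0 T, ∀ x, ‖u s x‖ ≤ V)
    (hY : ∀ s ∈ Icc 0 T, Integrable fun x => ‖curl (u s) x‖ ^ 2)
    (hYstar : ∀ s ∈ Icc 0 T, ∫ x, ‖curl (u s) x‖ ^ 2 ≤ Ystar)
    (hDi : ∀ s ∈ Icc 0 T, Integrable fun x => frobeniusNormSq (fderiv ℝ (curl (u s)) x))
    (hDstar : ∀ s ∈ Icc 0 T, ∫ x, frobeniusNormSq (fderiv ℝ (curl (u s)) x) ≤ Dstar)
    (hSi : ∀ s ∈ Icc 0 T, Integrable fun x =>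
      |hadamardQuotFst (fun y => curl (u s) y 1) x| * ‖curl (u s) x‖ * ‖u s x‖)
    {Φ : ℝ → ℝ} (hΦi : IntegrableOn Φ (Icc 0 T))
    (hΦ : ∀ s ∈ Icc 0 T,
      ∫ x, |hadamardQuotFst (fun y => curl (u s) y 1) x| * ‖curl (u s) x‖ * ‖u s x‖ ≤ Φ s)
    {t : ℝ} (ht : t ∈ Icc 0 T) :
    1 / 2 * (∫ x, ‖curl (u t) x‖ ^ 2 * Real.smoothTransition (2 - ‖x‖ ^ 2 / R ^ 2) ^ 2)
      - 1 / 2 * (∫ x, ‖curl (u 0) x‖ ^ 2 * Real.smoothTransition (2 - ‖x‖ ^ 2 / R ^ 2) ^ 2)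
      + ν * ∫ s in (0 : ℝ)..t, ∫ x, frobeniusNormSq (fderiv ℝ (curl (u s)) x) *
          Real.smoothTransition (2 - ‖x‖ ^ 2 / R ^ 2) ^ 2 ≤
      (6 * Real.sqrt 2 * ν * D * (Ystar + Dstar) + 2 * Real.sqrt 2 * D * V * Ystar) / R * t +
        ∫ s in (0 : ℝ)..t, Φ s := by
  set χ : EuclideanSpace ℝ (Fin 3) → ℝ := fun y =>
    Real.smoothTransition (2 - ‖y‖ ^ 2 / R ^ 2) ^ 2 with hχdef
  set C : ℝ := (6 * Real.sqrt 2 * ν * D * (Ystar + Dstar) + 2 * Real.sqrt 2 * D * V * Ystar) / R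
    with hCdef
  have hR0 : 0 < R := by linarith
  have hχcont : Continuous χ := (contDiff_sqBallCutoff R (n := 0)).continuous
  have hχc : HasCompactSupport χ := hasCompactSupport_sqBallCutoff hR0
  have htT : Icc 0 t ⊆ Icc 0 T := Icc_subset_Icc le_rfl ht.2
  -- the fundamental theorem of calculus for the localised enstrophy
  have hftc := localisedEnstrophy_sub_eq_integral hT hsol.smooth_velocity hχcont hχc ht
  rw [localisedEnstrophy_def, localisedEnstrophy_def] at hftc
  -- continuity in time of production and weighted dissipation
  have hPc := continuousOn_integral_enstrophyProduction_static hT hsol.smooth_velocity hχcont hχc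
  have hDc := continuousOn_localisedEnstrophyDissipation_static hT hsol.smooth_velocity hχcont hχc
  simp only [localisedEnstrophyDissipation_def] at hDc
  have hPint : IntervalIntegrable (fun s => ∫ x, enstrophyProduction T u s x * χ x) volume 0 t :=
    (hPc.mono htT).intervalIntegrable_of_Icc ht.1
  have hDint : IntervalIntegrable
      (fun s => ∫ x, frobeniusNormSq (fderiv ℝ (curl (u s)) x) * χ x) volume 0 t :=
    (hDc.mono htT).intervalIntegrable_of_Icc ht.1
  have hΦint : IntervalIntegrable Φ volume 0 t :=
    (intervalIntegrable_iff_integrableOn_Icc_of_le ht.1).2 (hΦi.mono_set htT)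
  -- the slice inequality at every time of `[0, t]`
  have hslice : ∀ s ∈ Icc 0 t, ∫ x, enstrophyProduction T u s x * χ x ≤
      -(ν * ∫ x, frobeniusNormSq (fderiv ℝ (curl (u s)) x) * χ x) + C + Φ s := by
    intro s hs
    have hs' : s ∈ Icc 0 T := htT hs
    exact enstrophyProduction_sqBallCutoff_le hT hν hsol hs' (hax s hs') (hsw s hs') hD hR
      (hV s hs') (hY s hs') (hYstar s hs') (hDi s hs') (hDstar s hs') (hSi s hs') (hΦ s hs')
  have i1 : IntervalIntegrable
      (fun s => -(ν * ∫ x, frobeniusNormSq (fderiv ℝ (curl (u s)) x) * χ x)) volume 0 t :=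
    (hDint.const_mul ν).neg
  have i12 : IntervalIntegrable
      (fun s => -(ν * ∫ x, frobeniusNormSq (fderiv ℝ (curl (u s)) x) * χ x) + C) volume 0 t :=
    i1.add intervalIntegrable_const
  have hmono := intervalIntegral.integral_mono_on ht.1 hPint (i12.add hΦint) hslice
  have hsplit : ∫ s in (0 : ℝ)..t, (-(ν * ∫ x, frobeniusNormSq (fderiv ℝ (curl (u s)) x) * χ x)
      + C + Φ s) = -(ν * ∫ s in (0 : ℝ)..t, ∫ x, frobeniusNormSq (fderiv ℝ (curl (u s)) x) * χ x)
      + C * t + ∫ s in (0 : ℝ)..t, Φ s := by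
    rw [intervalIntegral.integral_add i12 hΦint,
      intervalIntegral.integral_add i1 intervalIntegrable_const, intervalIntegral.integral_neg,
      intervalIntegral.integral_const_mul, intervalIntegral.integral_const]
    simp
    ring
  rw [hsplit] at hmono
  linarith [hmono, hftc]

end Integrated

/-! ### Measurability in time of the full-space enstrophy and dissipation -/

section Measurability

variable {T : ℝ} {w : ℝ → EuclideanSpace ℝ (Fin 3) → EuclideanSpace ℝ (Fin 3)}

/-- A time-dependent full-space integral whose ball-cutoff truncations are continuous in time is
a.e.-strongly measurable in time (pointwise limit of continuous functions). [folklore] -/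
theorem aestronglyMeasurable_integral_of_cutoff (hT : 0 < T)
    {g : ℝ → EuclideanSpace ℝ (Fin 3) → ℝ} (hg : ∀ s ∈ Icc 0 T, Integrable (g s))
    (hc : ∀ m : ℕ, ContinuousOn
      (fun s => ∫ x, g s x * Real.smoothTransition (2 - ‖x‖ ^ 2 / ((m : ℝ) + 1) ^ 2) ^ 2)
      (Icc 0 T)) :
    AEStronglyMeasurable (fun s => ∫ x, g s x) (volume.restrict (Icc 0 T)) := by
  have _ := hT
  refine aestronglyMeasurable_of_tendsto_ae atTop
    (fun m => (hc m).aestronglyMeasurable measurableSet_Icc) ?_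
  rw [ae_restrict_iff' measurableSet_Icc]
  exact ae_of_all _ fun s hs => tendsto_integral_mul_sqBallCutoff (hg s hs)

/-- **The enstrophy `t ↦ ∫|curl w(t)|²` is a.e.-strongly measurable on `[0, T]`** for a jointly
smooth field with square-integrable vorticity slices. [folklore] -/
theorem aestronglyMeasurable_enstrophy (hT : 0 < T) (hw : IsSmoothSpaceTimeOn (Icc 0 T) w)
    (hY : ∀ s ∈ Icc 0 T, Integrable fun x => ‖curl (w s) x‖ ^ 2) :
    AEStronglyMeasurable (fun s => ∫ x, ‖curl (w s) x‖ ^ 2) (volume.restrict (Icc 0 T)) := by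
  refine aestronglyMeasurable_integral_of_cutoff hT hY fun m => ?_
  have hR0 : (0 : ℝ) < (m : ℝ) + 1 := by positivity
  have h := continuousOn_localisedEnstrophy_static hT hw
    (contDiff_sqBallCutoff ((m : ℝ) + 1) (n := 0)).continuous (hasCompactSupport_sqBallCutoff hR0)
  simp only [localisedEnstrophy_def] at h
  have h2 := h.const_smul (2 : ℝ)
  refine h2.congr fun s _ => ?_
  simp only [Pi.smul_apply, smul_eq_mul]
  ring

/-- **The dissipation `t ↦ ∫|D curl w(t)|²_F` is a.e.-strongly measurable on `[0, T]`** for a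
jointly smooth field with square-integrable vorticity-gradient slices. [folklore] -/
theorem aestronglyMeasurable_dissipation (hT : 0 < T) (hw : IsSmoothSpaceTimeOn (Icc 0 T) w)
    (hD : ∀ s ∈ Icc 0 T, Integrable fun x => frobeniusNormSq (fderiv ℝ (curl (w s)) x)) :
    AEStronglyMeasurable (fun s => ∫ x, frobeniusNormSq (fderiv ℝ (curl (w s)) x))
      (volume.restrict (Icc 0 T)) := by
  refine aestronglyMeasurable_integral_of_cutoff hT hD fun m => ?_
  have hR0 : (0 : ℝ) < (m : ℝ) + 1 := by positivity
  have h := continuousOn_localisedEnstrophyDissipation_static hT hw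
    (contDiff_sqBallCutoff ((m : ℝ) + 1) (n := 0)).continuous (hasCompactSupport_sqBallCutoff hR0)
  simpa only [localisedEnstrophyDissipation_def] using h

end Measurability

/-! ### The enstrophy inequality on the whole space -/

section Whole

variable {T ν : ℝ} {u : ℝ → EuclideanSpace ℝ (Fin 3) → EuclideanSpace ℝ (Fin 3)}
  {p : ℝ → EuclideanSpace ℝ (Fin 3) → ℝ}

/-- **The enstrophy inequality for axisymmetric flows without swirl** (Lemarié-Rieusset 2016,
p. 289, integrated form with the stretching term kept as a majorant: from
`∂ₜ‖ω‖₂² = −2ν‖∇⊗ω‖₂² + 2∫ u_r ω_θ²/r dx` and `|u_r ω_θ²/r| ≤ |u| |ω_θ/r| |ω_θ|`). For a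
classical solution of the unforced Navier–Stokes system on `[0, T] × ℝ³`, axisymmetric without
swirl at all times, with `|u| ≤ V`, `ω(t), ∇ω(t) ∈ L²` uniformly, and a majorant
`Φ ∈ L¹(0,T)` with `∫ |f(s)| |ω(s)| |u(s)| dx ≤ Φ(s)` (`f = ω_θ/r`):
`‖ω(t)‖₂² + 2ν ∫₀ᵗ ‖∇ω‖²_{L²} ≤ ‖ω(0)‖₂² + 2∫₀ᵗ Φ` for `t ∈ [0, T]`
(`|∇ω|²` the squared Frobenius norm). Proof: `enstrophy_sqBallCutoff_integral_le` and `R → ∞`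
by dominated convergence in space and in time. [cite: LemarieRieusset2016, §10.3 p. 289] -/
theorem enstrophy_integral_le (hT : 0 < T) (hν : 0 ≤ ν)
    (hsol : IsClassicalNSSolutionOn (Icc 0 T) ν 0 u p)
    (hax : ∀ s ∈ Icc 0 T, IsAxisymmetric (u s)) (hsw : ∀ s ∈ Icc 0 T, HasNoSwirl (u s))
    {V Ystar Dstar : ℝ} (hV : ∀ s ∈ Icc 0 T, ∀ x, ‖u s x‖ ≤ V)
    (hY : ∀ s ∈ Icc 0 T, Integrable fun x => ‖curl (u s) x‖ ^ 2)
    (hYstar : ∀ s ∈ Icc 0 T, ∫ x, ‖curl (u s) x‖ ^ 2 ≤ Ystar)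
    (hDi : ∀ s ∈ Icc 0 T, Integrable fun x => frobeniusNormSq (fderiv ℝ (curl (u s)) x))
    (hDstar : ∀ s ∈ Icc 0 T, ∫ x, frobeniusNormSq (fderiv ℝ (curl (u s)) x) ≤ Dstar)
    (hSi : ∀ s ∈ Icc 0 T, Integrable fun x =>
      |hadamardQuotFst (fun y => curl (u s) y 1) x| * ‖curl (u s) x‖ * ‖u s x‖)
    {Φ : ℝ → ℝ} (hΦi : IntegrableOn Φ (Icc 0 T))
    (hΦ : ∀ s ∈ Icc 0 T,
      ∫ x, |hadamardQuotFst (fun y => curl (u s) y 1) x| * ‖curl (u s) x‖ * ‖u s x‖ ≤ Φ s)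
    {t : ℝ} (ht : t ∈ Icc 0 T) :
    (∫ x, ‖curl (u t) x‖ ^ 2) +
        2 * ν * ∫ s in (0 : ℝ)..t, ∫ x, frobeniusNormSq (fderiv ℝ (curl (u s)) x) ≤
      (∫ x, ‖curl (u 0) x‖ ^ 2) + 2 * ∫ s in (0 : ℝ)..t, Φ s := by
  obtain ⟨D, hD0, hD⟩ := Calculus.exists_bound_deriv_smoothTransition
  set C : ℝ := 6 * Real.sqrt 2 * ν * D * (Ystar + Dstar) + 2 * Real.sqrt 2 * D * V * Ystar
    with hCdef
  have h0T : (0 : ℝ) ∈ Icc 0 T := ⟨le_rfl, hT.le⟩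
  have htT : Icc 0 t ⊆ Icc 0 T := Icc_subset_Icc le_rfl ht.2
  -- the cutoff inequality for `R = m + 1`
  have hm : ∀ m : ℕ,
      1 / 2 * (∫ x, ‖curl (u t) x‖ ^ 2 *
          Real.smoothTransition (2 - ‖x‖ ^ 2 / ((m : ℝ) + 1) ^ 2) ^ 2)
      - 1 / 2 * (∫ x, ‖curl (u 0) x‖ ^ 2 *
          Real.smoothTransition (2 - ‖x‖ ^ 2 / ((m : ℝ) + 1) ^ 2) ^ 2)
      + ν * ∫ s in (0 : ℝ)..t, ∫ x, frobeniusNormSq (fderiv ℝ (curl (u s)) x) *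
          Real.smoothTransition (2 - ‖x‖ ^ 2 / ((m : ℝ) + 1) ^ 2) ^ 2 ≤
      C / ((m : ℝ) + 1) * t + ∫ s in (0 : ℝ)..t, Φ s := by
    intro m
    have hR1 : (1 : ℝ) ≤ (m : ℝ) + 1 := by
      have : (0 : ℝ) ≤ m := Nat.cast_nonneg m
      linarith
    exact enstrophy_sqBallCutoff_integral_le hT hν hsol hax hsw hD hR1 hV hY hYstar hDi hDstar hSi
      hΦi hΦ ht
  -- limits of the three cutoff quantities
  have hl1 := tendsto_integral_mul_sqBallCutoff (hY t ht)
  have hl2 := tendsto_integral_mul_sqBallCutoff (hY 0 h0T)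
  have hl3 : Tendsto (fun m : ℕ => ∫ s in (0 : ℝ)..t, ∫ x,
      frobeniusNormSq (fderiv ℝ (curl (u s)) x) *
        Real.smoothTransition (2 - ‖x‖ ^ 2 / ((m : ℝ) + 1) ^ 2) ^ 2) atTop
      (𝓝 (∫ s in (0 : ℝ)..t, ∫ x, frobeniusNormSq (fderiv ℝ (curl (u s)) x))) := by
    refine intervalIntegral.tendsto_integral_filter_of_dominated_convergence (fun _ => Dstar)
      (Eventually.of_forall fun m => ?_) (Eventually.of_forall fun m => ae_of_all _ fun s hs => ?_)
      intervalIntegrable_const (ae_of_all _ fun s hs => ?_)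
    · have hR0 : (0 : ℝ) < (m : ℝ) + 1 := by positivity
      have h := continuousOn_localisedEnstrophyDissipation_static hT hsol.smooth_velocity
        (contDiff_sqBallCutoff ((m : ℝ) + 1) (n := 0)).continuous
        (hasCompactSupport_sqBallCutoff hR0)
      simp only [localisedEnstrophyDissipation_def] at h
      have hsub : Ι 0 t ⊆ Icc 0 T := by
        rw [uIoc_of_le ht.1]; exact Ioc_subset_Icc_self.trans htT
      exact (h.mono hsub).aestronglyMeasurable measurableSet_uIoc
    · have hs' : s ∈ Icc 0 T := by
        rw [uIoc_of_le ht.1] at hs; exact htT (Ioc_subset_Icc_self hs)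
      have hw01 : ∀ x : EuclideanSpace ℝ (Fin 3),
          0 ≤ Real.smoothTransition (2 - ‖x‖ ^ 2 / ((m : ℝ) + 1) ^ 2) ^ 2 ∧
            Real.smoothTransition (2 - ‖x‖ ^ 2 / ((m : ℝ) + 1) ^ 2) ^ 2 ≤ 1 := fun x =>
        ⟨sqBallCutoff_nonneg _ x, sqBallCutoff_le_one _ x⟩
      have hint : Integrable fun x => frobeniusNormSq (fderiv ℝ (curl (u s)) x) *
          Real.smoothTransition (2 - ‖x‖ ^ 2 / ((m : ℝ) + 1) ^ 2) ^ 2 :=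
        (hDi s hs').mul_bdd (contDiff_sqBallCutoff _ (n := 0)).continuous.aestronglyMeasurable
          (ae_of_all _ fun x => by
            rw [Real.norm_eq_abs, abs_of_nonneg (hw01 x).1]; exact (hw01 x).2)
      have hnn : 0 ≤ ∫ x, frobeniusNormSq (fderiv ℝ (curl (u s)) x) *
          Real.smoothTransition (2 - ‖x‖ ^ 2 / ((m : ℝ) + 1) ^ 2) ^ 2 :=
        integral_nonneg fun x => mul_nonneg (frobeniusNormSq_nonneg _) (hw01 x).1
      have hle : ∫ x, frobeniusNormSq (fderiv ℝ (curl (u s)) x) *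
          Real.smoothTransition (2 - ‖x‖ ^ 2 / ((m : ℝ) + 1) ^ 2) ^ 2 ≤ Dstar := by
        refine (integral_mono hint (hDi s hs') fun x => ?_).trans (hDstar s hs')
        have h0 := frobeniusNormSq_nonneg (fderiv ℝ (curl (u s)) x)
        have := (hw01 x).2
        nlinarith
      rw [Real.norm_eq_abs, abs_of_nonneg hnn]
      exact hle
    · have hs' : s ∈ Icc 0 T := by
        rw [uIoc_of_le ht.1] at hs; exact htT (Ioc_subset_Icc_self hs)
      exact tendsto_integral_mul_sqBallCutoff (hDi s hs')
  have hl4 : Tendsto (fun m : ℕ => C / ((m : ℝ) + 1) * t + ∫ s in (0 : ℝ)..t, Φ s) atTop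
      (𝓝 (C * 0 * t + ∫ s in (0 : ℝ)..t, Φ s)) := by
    have h0 : Tendsto (fun m : ℕ => (1 : ℝ) / ((m : ℝ) + 1)) atTop (𝓝 0) :=
      tendsto_one_div_add_atTop_nhds_zero_nat
    have h1 : Tendsto (fun m : ℕ => C / ((m : ℝ) + 1)) atTop (𝓝 (C * 0)) := by
      refine ((tendsto_const_nhds (x := C)).mul h0).congr fun m => ?_
      ring
    exact (h1.mul tendsto_const_nhds).add tendsto_const_nhds
  have hlhs := ((hl1.const_mul (1 / 2 : ℝ)).sub (hl2.const_mul (1 / 2 : ℝ))).add (hl3.const_mul ν)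
  have := le_of_tendsto_of_tendsto' hlhs hl4 hm
  simp only [mul_zero, zero_mul, zero_add] at this
  linarith

end Whole

end Literature.Analysis.FluidPDE

end
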